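import Summits.SmoothPoincare4.SmoothPoincare4.Cruxes.CylinderRungTwo.IdeateSketchK1
import Literature.Geometry.Manifold.CylinderSlice
import Literature.Geometry.Riemannian.SphericalCylinderEntropy

/-!
# Crux-triage r1-1 evidence (crux `CylinderRungTwo`, stmt-SmoothPoincare4-7631):
# the first lemma `FluxIdentity` of card `killing-flux` is FALSE as typed

`Sketch.FluxIdentity` (`Cruxes/CylinderRungTwo/IdeateSketchK1.lean`) quantifies over ALL compact `M`
(no connectedness, no `M ≃ₕ S⁴`) and `Sketch.IsDefiningFunction ι f` imposes no sign condition at the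
LOWER end of the cylinder.  Witness: `M = S⁴ ⊔ S⁴` embedded as the two slices `z₅ = 0`, `z₅ = 1`
(tree `CylinderSlice.twoSlices`, the standing disprover's witness) with the defining function
`f z = z₅ (z₅ - 1)`, which is positive above AND below the configuration: its unit normal inside `N` is
`+e₅` on the top slice and `-e₅` on the bottom one, so the flux integral vanishes — proved here without
any finiteness bookkeeping, by the reflection `z₅ ↦ 1 - z₅`, an isometry of `ℝ⁶` preserving `μH[4]` and the
configuration and reversing the integrand — while the right-hand side `(μH[4] S⁴).toReal` is positive
(tree `SphericalCylinderEntropy.hausdorffMeasure_sphere_four_pos/_lt_top`).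

Repair proposed in `TRIAGE-r1-1.md`: add `∃ R, ∀ z ∈ Ncyl, z 5 ≤ -R → f z < 0` to `IsDefiningFunction`
(then the flux is `vol S⁴` for every compact `M`, disconnected ones included), or add `[ConnectedSpace M]`.
-/

noncomputable section

open scoped Manifold ContDiff RealInnerProductSpace Topology ENNReal
open MeasureTheory Set InnerProductSpace

set_option linter.dupNamespace false

namespace Summit.SmoothPoincare4.SmoothPoincare4.Cruxes.CylinderRungTwo.Triage

open Sketch
open Literature.Geometry.Manifold.CylinderSlice hiding axis
open Literature.Geometry.Riemannian.SphericalCylinderEntropy (hausdorffMeasure_sphere_four_pos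
  hausdorffMeasure_sphere_four_lt_top)

/-- The height functional `z ↦ z₅` as a continuous linear map. -/
abbrev π5 : E6 →L[ℝ] ℝ := EuclideanSpace.proj (5 : Fin 6)

@[simp] theorem π5_apply (z : E6) : π5 z = z 5 := rfl

/-- The bad defining function `f(z) = z₅ (z₅ - 1)` of the two-slice configuration. -/
def fbad : E6 → ℝ := fun z => π5 z * (π5 z - 1)

theorem fbad_apply (z : E6) : fbad z = z 5 * (z 5 - 1) := rfl

theorem contDiff_fbad : ContDiff ℝ ∞ fbad :=
  π5.contDiff.mul (π5.contDiff.sub contDiff_const)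

theorem hasFDerivAt_fbad (z : E6) : HasFDerivAt fbad ((2 * z 5 - 1) • π5) z := by
  have h : HasFDerivAt fbad (π5 z • π5 + (π5 z - 1) • π5) z :=
    π5.hasFDerivAt.mul (π5.hasFDerivAt.sub_const 1)
  have e : (2 * z 5 - 1) • π5 = π5 z • π5 + (π5 z - 1) • π5 := by
    rw [← add_smul]
    congr 1
    show (2 * z 5 - 1 : ℝ) = z 5 + (z 5 - 1)
    ring
  rw [e]; exact h

theorem hasGradientAt_fbad (z : E6) : HasGradientAt fbad ((2 * z 5 - 1) • axis) z := by
  have e : toDual ℝ E6 ((2 * z 5 - 1) • axis) = (2 * z 5 - 1) • π5 := by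
    ext w
    rw [toDual_apply_apply]
    simp [axis, real_inner_smul_left, EuclideanSpace.inner_single_left]
  rw [hasGradientAt_iff_hasFDerivAt, e]
  exact hasFDerivAt_fbad z

theorem gradient_fbad (z : E6) : gradient fbad z = (2 * z 5 - 1) • axis :=
  (hasGradientAt_fbad z).gradient

theorem inner_axis_base (z : E6) : ⟪axis, base z⟫ = 0 := by
  simp [axis, base, EuclideanSpace.inner_single_left]

theorem gradN_fbad (z : E6) : gradN fbad z = (2 * z 5 - 1) • axis := by
  rw [gradN, gradient_fbad, real_inner_smul_left, inner_axis_base, mul_zero, zero_smul, sub_zero]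

theorem axis_ne_zero : (axis : E6) ≠ 0 := by
  simp [axis]

/-- On the configuration (`z₅ ∈ {0, 1}`) the integrand of `FluxIdentity` is `2 z₅ - 1 = ∓1`. -/
theorem inner_axis_unitNormalN_fbad (z : E6) (h : z 5 = 0 ∨ z 5 = 1) :
    ⟪axis, unitNormalN fbad z⟫ = 2 * z 5 - 1 := by
  have hc : |2 * z 5 - 1| = 1 := by rcases h with h | h <;> rw [h] <;> norm_num
  have hnorm : ‖(2 * z 5 - 1) • (axis : E6)‖ = 1 := by
    rw [norm_smul, Real.norm_eq_abs, hc, one_mul]; simp [axis]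
  rw [unitNormalN, gradN_fbad, hnorm, inv_one, one_smul, real_inner_smul_right]
  simp [axis]

/-! ### The reflection `z₅ ↦ 1 - z₅` -/

/-- Reflection of `ℝ⁶` in the hyperplane `z₅ = 1/2`. -/
def refl (z : E6) : E6 := z + (1 - 2 * z 5) • axis

theorem refl_apply_five (z : E6) : refl z 5 = 1 - z 5 := by
  have : refl z 5 = z 5 + (1 - 2 * z 5) := by simp [refl, axis]
  rw [this]; ring

theorem refl_apply_castSucc (z : E6) (i : Fin 5) : refl z (Fin.castSucc i) = z (Fin.castSucc i) := by
  simp [refl, axis, castSucc_ne_five i]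

theorem refl_refl (z : E6) : refl (refl z) = z := by
  ext j
  induction j using Fin.lastCases with
  | last =>
    rw [show (Fin.last 5 : Fin 6) = 5 from rfl, refl_apply_five, refl_apply_five]; ring
  | cast i => rw [refl_apply_castSucc, refl_apply_castSucc]

theorem refl_surjective : Function.Surjective refl := fun z => ⟨refl z, refl_refl z⟩

theorem isometry_refl : Isometry refl := by
  refine Isometry.of_dist_eq fun x y => ?_
  simp only [dist_eq_norm, EuclideanSpace.norm_eq]
  congr 1
  rw [Fin.sum_univ_castSucc (n := 5), Fin.sum_univ_castSucc (n := 5)]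
  simp only [show (Fin.last 5 : Fin 6) = 5 from rfl, PiLp.sub_apply, refl_apply_castSucc,
    refl_apply_five, Real.norm_eq_abs, sq_abs]
  ring

theorem refl_preimage_range : refl ⁻¹' Set.range twoSlices = Set.range twoSlices := by
  ext z
  simp only [mem_preimage, range_twoSlices, mem_union, mem_setOf_eq, refl_apply_five,
    refl_apply_castSucc]
  constructor
  · rintro (⟨h1, h2⟩ | ⟨h1, h2⟩)
    · exact Or.inr ⟨h1, by linarith⟩
    · exact Or.inl ⟨h1, by linarith⟩
  · rintro (⟨h1, h2⟩ | ⟨h1, h2⟩)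
    · exact Or.inr ⟨h1, by linarith⟩
    · exact Or.inl ⟨h1, by linarith⟩

theorem mem_range_twoSlices_five {z : E6} (hz : z ∈ Set.range twoSlices) : z 5 = 0 ∨ z 5 = 1 := by
  rw [range_twoSlices] at hz
  rcases hz with ⟨-, h⟩ | ⟨-, h⟩
  · exact Or.inl h
  · exact Or.inr h

/-! ### The flux integral of the witness vanishes -/

theorem flux_integral_eq_zero :
    ∫ z in Set.range twoSlices, ⟪axis, unitNormalN fbad z⟫ ∂μH[4] = 0 := by
  have hSm : MeasurableSet (Set.range twoSlices) :=
    (isCompact_range isSmoothEmbedding_twoSlices.isEmbedding.continuous).isClosed.measurableSet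
  have hme : MeasurableEmbedding refl := isometry_refl.isClosedEmbedding.measurableEmbedding
  have hmap : Measure.map refl (μH[4] : Measure E6) = μH[4] := by
    rw [isometry_refl.map_hausdorffMeasure (Or.inr refl_surjective), refl_surjective.range_eq,
      Measure.restrict_univ]
  have h1 : ∫ z in Set.range twoSlices, ⟪axis, unitNormalN fbad z⟫ ∂μH[4] =
      ∫ z in Set.range twoSlices, ⟪axis, unitNormalN fbad (refl z)⟫ ∂μH[4] := by
    conv_lhs => rw [← hmap]
    rw [hme.restrict_map, refl_preimage_range, hme.integral_map]
  have h2 : ∫ z in Set.range twoSlices, ⟪axis, unitNormalN fbad (refl z)⟫ ∂μH[4] =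
      ∫ z in Set.range twoSlices, -⟪axis, unitNormalN fbad z⟫ ∂μH[4] := by
    refine setIntegral_congr_fun hSm fun z hz => ?_
    have hz5 : z 5 = 0 ∨ z 5 = 1 := mem_range_twoSlices_five hz
    have hrz : refl z ∈ Set.range twoSlices := by
      rw [← refl_preimage_range] at hz
      exact hz
    have hrz5 : refl z 5 = 0 ∨ refl z 5 = 1 := mem_range_twoSlices_five hrz
    show ⟪axis, unitNormalN fbad (refl z)⟫ = -⟪axis, unitNormalN fbad z⟫
    rw [inner_axis_unitNormalN_fbad _ hrz5, inner_axis_unitNormalN_fbad _ hz5, refl_apply_five]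
    ring
  have h3 : ∫ z in Set.range twoSlices, -⟪axis, unitNormalN fbad z⟫ ∂μH[4] =
      -∫ z in Set.range twoSlices, ⟪axis, unitNormalN fbad z⟫ ∂μH[4] :=
    integral_neg _
  linarith [h1, h2, h3]

/-- `fbad` IS a defining function of the two-slice configuration in the typed sense. -/
theorem isDefiningFunction_fbad : IsDefiningFunction twoSlices fbad := by
  refine ⟨contDiff_fbad, ?_, ?_, ⟨2, ?_⟩⟩
  · intro z hz
    simp only [Ncyl, mem_setOf_eq] at hz
    rw [range_twoSlices]
    simp only [mem_union, mem_setOf_eq, fbad_apply, mul_eq_zero, sub_eq_zero, hz, true_and]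
  · intro x
    rw [gradN_fbad]
    have hx : twoSlices x 5 = 0 ∨ twoSlices x 5 = 1 := by
      rcases x with x | x <;> simp [twoSlices]
    have hc : (2 * twoSlices x 5 - 1) ≠ 0 := by
      rcases hx with h | h <;> rw [h] <;> norm_num
    exact smul_ne_zero hc axis_ne_zero
  · intro z _ hz
    rw [fbad_apply]
    nlinarith

/-- The two slices separate the ends (the bottom slice alone does). -/
theorem separatesEnds_twoSlices :
    ∃ R : ℝ, ∀ a b : EuclideanSpace ℝ (Fin 6), ∑ i : Fin 5, a (Fin.castSucc i) ^ 2 = 1 →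
      ∑ i : Fin 5, b (Fin.castSucc i) ^ 2 = 1 → a 5 ≤ -R → R ≤ b 5 →
        ¬ JoinedIn ({z : EuclideanSpace ℝ (Fin 6) | ∑ i : Fin 5, z (Fin.castSucc i) ^ 2 = 1} \
          Set.range twoSlices) a b :=
  separatesEnds_of_slice_subset (c := 0) (by rw [range_twoSlices]; exact subset_union_left)

/-- **`FluxIdentity` (card `killing-flux`, IdeateSketchK1) is false as typed.** -/
theorem fluxIdentity_false : ¬ FluxIdentity := by
  intro h
  have key := h ((Metric.sphere (0 : EuclideanSpace ℝ (Fin 5)) 1) ⊕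
      (Metric.sphere (0 : EuclideanSpace ℝ (Fin 5)) 1)) twoSlices isSmoothEmbedding_twoSlices
    sum_sq_twoSlices separatesEnds_twoSlices fbad isDefiningFunction_fbad
  rw [flux_integral_eq_zero] at key
  have hpos : 0 < (μH[4] (Metric.sphere (0 : EuclideanSpace ℝ (Fin 5)) 1)).toReal :=
    ENNReal.toReal_pos hausdorffMeasure_sphere_four_pos.ne' hausdorffMeasure_sphere_four_lt_top.ne
  linarith

end Summit.SmoothPoincare4.SmoothPoincare4.Cruxes.CylinderRungTwo.Triage
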